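import Summits.ResolutionOfSingularities.ResolutionOfSingularities.Theorems.ValuativeLuAlphaPTorsorKnownRanges
import Literature.AlgebraicGeometry.Resolution.AffineDomainEquidim
import Literature.AlgebraicGeometry.Resolution.AffineDomainDimension
import Literature.AlgebraicGeometry.Resolution.LocalBlowup
import Mathlib.Algebra.Module.SpanRank
import HarnessLib

/-!
# Very good charts are regular at the centre

Crux `Valuative.LuAlphaPTorsor` (item `stmt-ResolutionOfSingularities-0641`), line
`pfaff-line-log-final-forms`, reshape v6 (lead seat c4), assembly S6: the regularity lemma.

A **very good chart** of a zero-dimensional valuation ring `O ⊇ k` of `K` is a finitely generated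
`k`-subalgebra `R ⊆ O` with `Frac R = K` whose CENTRE `𝔪_O ∩ R` is generated, as an ideal of `R`,
by `n = trdeg_k K` elements. Then `R` is regular at the centre: the centre `𝔭` is a maximal ideal
(`R/𝔭` is a domain algebraic over `k`), so `dim R_𝔭 = dim R = trdeg_k K = n` (affine domains are
equidimensional at closed points, `ringKrullDim_localization_atPrime_eq_of_isMaximal`), while
`𝔭 R_𝔭` is generated by `n` elements; `IsRegularLocalRing.of_spanFinrank_maximalIdeal_le`.
-/

set_option linter.dupNamespace false

open IsLocalRing

namespace Summit.ResolutionOfSingularities.ResolutionOfSingularities.Theorems.PfaffLine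

open Literature.AlgebraicGeometry.Resolution

variable {k K : Type} [Field k] [Field K] [Algebra k K]

/-- The centre of a zero-dimensional valuation ring on a finitely generated subalgebra `R ⊆ O`
is a MAXIMAL ideal of `R`: the quotient is a domain all of whose elements are algebraic over `k`
(a non-zero `f ∈ k[X]` with `f(z) ∈ 𝔪_O` kills the class of `z ∈ R`). [folklore] -/
theorem isMaximal_centre_of_zeroDim (O : ValuationSubring K)
    (hzd : ∀ z : K, z ∈ O → ∃ f : Polynomial k, f ≠ 0 ∧ Polynomial.aeval z f ∈ O.nonunits)
    (R : Subalgebra k K) (hRO : R.toSubring ≤ O.toSubring) :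
    (Ideal.comap (Subring.inclusion hRO) (maximalIdeal O)).IsMaximal := by
  classical
  set 𝔭 : Ideal R.toSubring := Ideal.comap (Subring.inclusion hRO) (maximalIdeal O) with h𝔭
  haveI h𝔭p : 𝔭.IsPrime := Ideal.comap_isPrime _ _
  -- `R/𝔭` is a domain, algebraic over the field `k`, hence a field
  letI : Algebra k R.toSubring := R.algebra
  haveI : IsDomain (R.toSubring ⧸ 𝔭) := Ideal.Quotient.isDomain 𝔭
  have hint : Algebra.IsIntegral k (R.toSubring ⧸ 𝔭) := by
    refine ⟨fun z => ?_⟩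
    obtain ⟨r, rfl⟩ := Ideal.Quotient.mk_surjective z
    obtain ⟨f, hf0, hf⟩ := hzd (r : K) (hRO r.2)
    refine IsAlgebraic.isIntegral ⟨f, hf0, ?_⟩
    have h1 : Polynomial.aeval (Ideal.Quotient.mk 𝔭 r) f =
        Ideal.Quotient.mkₐ k 𝔭 (Polynomial.aeval r f) := by
      rw [← Polynomial.aeval_algHom_apply]
      rfl
    rw [h1, Ideal.Quotient.mkₐ_eq_mk, Ideal.Quotient.eq_zero_iff_mem, h𝔭, Ideal.mem_comap]
    have h2 : ((Polynomial.aeval r f : R.toSubring) : K) = Polynomial.aeval (r : K) f :=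
      (Subalgebra.aeval_coe R r f).symm
    have h3 : O.valuation ((Polynomial.aeval r f : R.toSubring) : K) < 1 := by
      rw [h2]
      exact (ValuationSubring.mem_nonunits_iff O).mp hf
    exact (ValuationSubring.valuation_lt_one_iff O _).mpr h3
  have hfield : IsField (R.toSubring ⧸ 𝔭) := by
    haveI := hint
    exact (Algebra.IsIntegral.isField_iff_isField (R := k) (S := R.toSubring ⧸ 𝔭)
      (FaithfulSMul.algebraMap_injective k _)).mp (Field.toIsField k)
  exact Ideal.Quotient.maximal_of_isField 𝔭 hfield

/-- **A very good chart is regular at its centre.** For a zero-dimensional valuation ring `O ⊇ k`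
of `K`, a finitely generated `R ⊆ O` with `Frac R = K`, and `x₁, …, xₙ ∈ R` generating the centre
`𝔪_O ∩ R` where `n = trdeg_k K`: the local ring of `R` at the centre is regular (its dimension is
`dim R = trdeg_k K = n`, its maximal ideal is generated by `n` elements). [folklore] -/
theorem isRegularLocalRing_of_chart :
    ∀ (k K : Type) [Field k] [Field K] [Algebra k K] (O : ValuationSubring K), (∀ z : K, z ∈ O → ∃ f : Polynomial k, f ≠ 0 ∧ Polynomial.aeval z f ∈ O.nonunits) → ∀ (n : ℕ) (R : Subalgebra k K) (hRO : R.toSubring ≤ O.toSubring) (x : Fin n → K) (hx : ∀ i, x i ∈ R), R.FG → IsFractionRing R K → Ideal.span (Set.range fun i => (⟨x i, hx i⟩ : R.toSubring)) = Ideal.comap (Subring.inclusion hRO) (IsLocalRing.maximalIdeal O) → Algebra.trdeg k K = n → IsRegularLocalRing (Localization.AtPrime (Ideal.comap (Subring.inclusion hRO) (IsLocalRing.maximalIdeal O))) := by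
  intro k K _ _ _ O hzd n R hRO x hx hfg hfrK hspan htr
  classical
  haveI := hfrK
  haveI h𝔭p : (Ideal.comap (Subring.inclusion hRO) (maximalIdeal O)).IsPrime :=
    Ideal.comap_isPrime _ _
  haveI h𝔭m : (Ideal.comap (Subring.inclusion hRO) (maximalIdeal O)).IsMaximal :=
    isMaximal_centre_of_zeroDim O hzd R hRO
  letI : Algebra k R.toSubring := R.algebra
  haveI : Algebra.FiniteType k R.toSubring := R.fg_iff_finiteType.mp hfg
  haveI : IsNoetherianRing R.toSubring := isNoetherianRing_of_fg hfg
  -- `dim R_𝔭 = dim R = trdeg_k K = n`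
  have hdimR : ringKrullDim R.toSubring = n := by
    obtain ⟨n', hn', htr'⟩ := exists_ringKrullDim_eq_and_trdeg_eq k R.toSubring
    have h1 : Algebra.trdeg k K = Algebra.trdeg k R := trdeg_eq_trdeg_of_isFractionRing R
    have h2 : (n : Cardinal) = n' := by
      rw [← htr', ← htr, h1]
      rfl
    have h3 : n = n' := by exact_mod_cast h2
    rw [hn', h3]
  have hdim : ringKrullDim (Localization.AtPrime
      (Ideal.comap (Subring.inclusion hRO) (maximalIdeal O))) = n := by
    rw [ringKrullDim_localization_atPrime_eq_of_isMaximal k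
      (Ideal.comap (Subring.inclusion hRO) (maximalIdeal O)), hdimR]
  -- `𝔭 R_𝔭` is generated by the `n` images of the `xᵢ`
  apply IsRegularLocalRing.of_spanFinrank_maximalIdeal_le
  have hmap : Ideal.map (algebraMap R.toSubring (Localization.AtPrime
      (Ideal.comap (Subring.inclusion hRO) (maximalIdeal O))))
      (Ideal.span (Set.range fun i => (⟨x i, hx i⟩ : R.toSubring))) =
      Ideal.map (algebraMap R.toSubring (Localization.AtPrime
      (Ideal.comap (Subring.inclusion hRO) (maximalIdeal O))))
      (Ideal.comap (Subring.inclusion hRO) (maximalIdeal O)) := by rw [hspan]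
  rw [hdim, ← Localization.AtPrime.map_eq_maximalIdeal, ← hmap, Ideal.map_span,
    ← Set.range_comp]
  have hfin : (Set.range ((algebraMap R.toSubring (Localization.AtPrime
      (Ideal.comap (Subring.inclusion hRO) (maximalIdeal O)))) ∘
      fun i => (⟨x i, hx i⟩ : R.toSubring))).Finite := Set.finite_range _
  have hle := Submodule.spanFinrank_span_le_ncard_of_finite
    (R := Localization.AtPrime (Ideal.comap (Subring.inclusion hRO) (maximalIdeal O))) hfin
  have hcard : (Set.range ((algebraMap R.toSubring (Localization.AtPrime
      (Ideal.comap (Subring.inclusion hRO) (maximalIdeal O)))) ∘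
      fun i => (⟨x i, hx i⟩ : R.toSubring))).ncard ≤ n := by
    rw [← Set.image_univ]
    refine (Set.ncard_image_le Set.finite_univ).trans ?_
    rw [Set.ncard_univ, Nat.card_eq_fintype_card, Fintype.card_fin]
  exact_mod_cast hle.trans hcard

end Summit.ResolutionOfSingularities.ResolutionOfSingularities.Theorems.PfaffLine
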